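import Mathlib.LinearAlgebra.FiniteDimensional.Lemmas
import Mathlib.LinearAlgebra.Dual.Lemmas
import Mathlib.LinearAlgebra.Span.Basic
import HarnessLib

/-!
# An irreducible Lie algebra of endomorphisms containing a rank-one IDEMPOTENT is all of `𝔤𝔩(W)` (matrix units from `diag(1, 0, …, 0)`, Humphreys §19.1–19.2)

Topic `Literature/Algebra/Lie` (namespace `Literature.Algebra.Lie`). THEOREMS ONLY (no definition, no instance, no named fact, no `sorry`).
Written for the cell `pub-hodgeav-hg6` (req-37 (A) Q2b; eng-4 g7, groundwork S1 for the bricks Y1/Y2 of the (3|3) WEIL square,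
`HOME/jobs/WEIL33-eng4g7/DESIGN.md` §3: the degree-zero part `𝔊⁰` of `(Lie Hg)_ℂ|_W` acts irreducibly on `W⁺` and contains the
rank-one NON-nilpotent operators `N N†` attached to rank-one raising elements `N`). HONEST FRAMING: pure linear algebra; nothing here is
about Hodge theory or HC; no step towards a summit statement. VOCABULARY-FREE, in the style of the tree's
`IrreducibleLinearLieAlgebraPlane` and `HodgeThetaSubalgebraLeviCorners`: `𝔏 : Submodule K (Module.End K W)` closed under `AB − BA`,
irreducibility as «no `𝔏`-stable subspace other than `0`, `W`»; no Lie structure on `Module.End K W` is mentioned.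

THE STATEMENT (**`eq_top_of_irreducible_of_idempotent_rankOne`**). Let `K` be a field of characteristic `0`, `W` a finite-dimensional
`K`-space, `𝔏 ⊆ End_K(W)` a subspace closed under the commutator which leaves no subspace other than `0` and `W` invariant, and
`E ∈ 𝔏` an IDEMPOTENT OF RANK ONE (`E² = E`, `E W = K u`, `u ≠ 0`). Then `𝔏 = End_K(W)`. (The hypothesis «idempotent» cannot be
dropped: `𝔰𝔭(W)` is irreducible and contains rank-one NILPOTENT operators.)

THE MECHANISM (Humphreys, GTM 9, §19.1 Proposition «a subalgebra of `𝔤𝔩(V)` acting irreducibly is reductive» and §19.2 «multiplying …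
by suitable `diag(0, …, 1, …, 0)` yields all the off-diagonal matrix units `e_ij`» [held `book:humphreys1972-…` p. 139–140]; Hoffman–Kunze
§6.7: `W = EW ⊕ ker E` for a projection). Write `E x = ε(x) u` (`ε(u) = 1`), `W = Ku ⊕ ker E`. Since `E ∈ 𝔏`, the corners
`n_Z = EZ(1 − E)` (maps `ker E → Ku`) and `m_Z = (1 − E)ZE` (maps `Ku → ker E`) of every `Z ∈ 𝔏` lie in `𝔏` (`corner_mem`; uses
`2 ≠ 0`). (A) `Ku + {(1 − E)Zu : Z ∈ 𝔏}` is `𝔏`-stable, hence `= W`: EVERY `k ∈ ker E` is `m_Z u` — all operators `k ⊗ ε` lie in `𝔏`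
(`exists_corner_apply_eq`). (B) `{k ∈ ker E : EZk = 0 ∀ Z ∈ 𝔏}` is `𝔏`-stable and misses `u`, hence `= 0`; by a dimension count the
functionals `ε ∘ Z ∘ (1 − E)`, `Z ∈ 𝔏`, are ALL functionals vanishing at `u` — all operators `u ⊗ γ`, `γ(u) = 0`, lie in `𝔏`
(`exists_corner_eq_smulRight`). (C) `[u ⊗ γ, k ⊗ ε] = γ(k)E − k ⊗ γ`, so every `k ⊗ γ` lies in `𝔏`; with `EFE = ε(Fu)E` every
`F = EFE + EF(1−E) + (1−E)FE + (1−E)F(1−E)` lies in `𝔏`.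

## References

* [Humphreys1972] J. E. Humphreys, *Introduction to Lie Algebras and Representation Theory*, GTM 9 (1972), §19.1 (Proposition) and §19.2
  (matrix units from `diag(0,…,1,…,0)`; irreducibility of the classical algebras).
* [HoffmanKunze1971LinearAlgebra] K. Hoffman, R. Kunze, *Linear Algebra* (2nd ed. 1971), §6.7 (projections: `V = range E ⊕ null E`).
-/

namespace Literature.Algebra.Lie

open Module

variable {K : Type*} [Field K] [CharZero K] {W : Type*} [AddCommGroup W] [Module K W]

/-! ### §1 Corners of an idempotent -/

/-- The corners `EZ(1 − E)`, `(1 − E)ZE` and the diagonal part `EZE + (1 − E)Z(1 − E)` of `Z ∈ 𝔏` lie in `𝔏` when the idempotent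
`E` does: `[E, Z] = n − m`, `[E, [E, Z]] = n + m` (`2 ≠ 0`). The tree's `LeviCorner.diag_mem`, over any field of characteristic `0`.
[cite: Humphreys1972, §19.1–§19.2] [cite: HoffmanKunze1971LinearAlgebra, §6.7] -/
theorem corner_mem {𝔏 : Submodule K (Module.End K W)} (hbr : ∀ A ∈ 𝔏, ∀ B ∈ 𝔏, A * B - B * A ∈ 𝔏)
    {E : Module.End K W} (hE : E ∈ 𝔏) (hEE : E * E = E) {Z : Module.End K W} (hZ : Z ∈ 𝔏) :
    E * Z * (1 - E) ∈ 𝔏 ∧ (1 - E) * Z * E ∈ 𝔏 ∧ E * Z * E + (1 - E) * Z * (1 - E) ∈ 𝔏 := by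
  have h1 : E * Z - Z * E ∈ 𝔏 := hbr E hE Z hZ
  have h2 : E * (E * Z - Z * E) - (E * Z - Z * E) * E ∈ 𝔏 := hbr E hE _ h1
  have e1 : E * Z - Z * E = E * Z * (1 - E) - (1 - E) * Z * E := by
    simp only [mul_sub, mul_one, sub_mul, one_mul, mul_assoc]; abel
  have e2 : E * (E * Z - Z * E) - (E * Z - Z * E) * E = E * Z * (1 - E) + (1 - E) * Z * E := by
    rw [mul_sub, sub_mul, ← mul_assoc, hEE, mul_assoc Z E E, hEE]
    simp only [mul_sub, mul_one, sub_mul, one_mul, mul_assoc]; abel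
  rw [e1] at h1
  rw [e2] at h2
  have hn : E * Z * (1 - E) ∈ 𝔏 := by
    have h := 𝔏.add_mem h1 h2
    rw [sub_add_add_cancel, ← two_smul K] at h
    exact (Submodule.smul_mem_iff _ two_ne_zero).1 h
  have hm : (1 - E) * Z * E ∈ 𝔏 := by
    have h := 𝔏.sub_mem h2 h1
    rw [add_sub_sub_cancel, ← two_smul K] at h
    exact (Submodule.smul_mem_iff _ two_ne_zero).1 h
  refine ⟨hn, hm, ?_⟩
  have e3 : E * Z * E + (1 - E) * Z * (1 - E) = Z - E * Z * (1 - E) - (1 - E) * Z * E := by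
    simp only [mul_sub, mul_one, sub_mul, one_mul, mul_assoc]; abel
  rw [e3]
  exact 𝔏.sub_mem (𝔏.sub_mem hZ hn) hm

/-! ### §2 The theorem -/

variable [FiniteDimensional K W]

set_option maxHeartbeats 1600000 in
/-- **An irreducible commutator-closed subspace `𝔏 ⊆ End_K(W)` containing a rank-one idempotent is all of `End_K(W)`** (`K` of
characteristic `0`, `W` finite-dimensional; rank one: `E² = E`, `E x = ε(x) u` for a functional `ε` and a vector `u` with `ε(u) = 1`).
Humphreys §19.2 («from `diag(0,…,1,…,0)` … all the matrix units»), run inside an irreducible `𝔏`: the lower corner `(1−E)𝔏E` reaches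
every `k ∈ ker E` (else `Ku ⊕ (1−E)𝔏Eu` is a proper invariant subspace), the upper corner `E𝔏(1−E)` realises every functional
killing `u` (else its common kernel in `ker E` is a proper invariant subspace), and brackets of the two give `End(ker E)`.
[cite: Humphreys1972, §19.1 Proposition and §19.2] [cite: HoffmanKunze1971LinearAlgebra, §6.7] -/
theorem eq_top_of_irreducible_of_idempotent_rankOne {𝔏 : Submodule K (Module.End K W)}
    (hbr : ∀ A ∈ 𝔏, ∀ B ∈ 𝔏, A * B - B * A ∈ 𝔏)
    (hirr : ∀ U : Submodule K W, (∀ A ∈ 𝔏, ∀ x ∈ U, A x ∈ U) → U = ⊥ ∨ U = ⊤)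
    {E : Module.End K W} (hE : E ∈ 𝔏) {ε : Module.Dual K W} {u : W} (hEapply : ∀ x, E x = ε x • u) (hεu : ε u = 1) :
    𝔏 = ⊤ := by
  classical
  -- basic identities
  have hu0 : u ≠ 0 := fun h => by
    have h1 := hεu
    rw [h, map_zero] at h1
    exact zero_ne_one h1
  have hEu : E u = u := by rw [hEapply, hεu, one_smul]
  have hεE : ∀ x, ε (E x) = ε x := fun x => by rw [hEapply, map_smul, hεu, smul_eq_mul, mul_one]
  have hEE : E * E = E := LinearMap.ext fun x => by
    rw [Module.End.mul_apply, hEapply (E x), hεE, ← hEapply]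
  have h1E : ∀ x, (1 - E) x = x - E x := fun x => by rw [LinearMap.sub_apply, Module.End.one_apply]
  have h1Eu : (1 - E) u = 0 := by rw [h1E, hEu, sub_self]
  have hE1E : ∀ x, E ((1 - E) x) = 0 := fun x => by
    rw [h1E, map_sub, ← Module.End.mul_apply, hEE, sub_self]
  have hε1E : ∀ x, ε ((1 - E) x) = 0 := fun x => by rw [h1E, map_sub, hεE, sub_self]
  have h1E1E : ∀ x, (1 - E) ((1 - E) x) = (1 - E) x := fun x => by
    rw [h1E ((1 - E) x), hE1E, sub_zero]
  have hcorner := fun Z (hZ : Z ∈ 𝔏) => corner_mem hbr hE hEE hZ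
  -- (A) every `k` with `E k = 0` is `(1 − E) Z u` for some `Z ∈ 𝔏`
  have hA : ∀ w : W, ∃ Z ∈ 𝔏, (1 - E) w = (1 - E) (Z u) := by
    set R : Submodule K W := Submodule.span K {y | ∃ Z ∈ 𝔏, y = (1 - E) (Z u)} with hRdef
    -- `R` is the image of `𝔏` under `Z ↦ (1−E) Z u`
    have hRmem : ∀ z ∈ R, ∃ Z ∈ 𝔏, z = (1 - E) (Z u) := by
      intro z hz
      induction hz using Submodule.span_induction with
      | mem y hy => exact hy
      | zero => exact ⟨0, 𝔏.zero_mem, by rw [LinearMap.zero_apply, map_zero]⟩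
      | add y y' _ _ hy hy' =>
        obtain ⟨Z, hZ, rfl⟩ := hy
        obtain ⟨Z', hZ', rfl⟩ := hy'
        exact ⟨Z + Z', 𝔏.add_mem hZ hZ', by rw [LinearMap.add_apply, map_add]⟩
      | smul a y _ hy =>
        obtain ⟨Z, hZ, rfl⟩ := hy
        exact ⟨a • Z, 𝔏.smul_mem _ hZ, by rw [LinearMap.smul_apply, map_smul]⟩
    set U' : Submodule K W := (K ∙ u) ⊔ R with hU'def
    have huU' : u ∈ U' := Submodule.mem_sup_left (Submodule.mem_span_singleton_self u)
    have hgenU' : ∀ Z ∈ 𝔏, (1 - E) (Z u) ∈ U' := fun Z hZ =>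
      Submodule.mem_sup_right (Submodule.subset_span ⟨Z, hZ, rfl⟩)
    have hYu : ∀ Y ∈ 𝔏, Y u ∈ U' := fun Y hY => by
      have h : Y u = ε (Y u) • u + (1 - E) (Y u) := by rw [h1E, ← hEapply, add_sub_cancel]
      rw [h]
      exact Submodule.add_mem _ (Submodule.smul_mem _ _ huU') (hgenU' Y hY)
    have hXgen : ∀ X ∈ 𝔏, ∀ Z ∈ 𝔏, X ((1 - E) (Z u)) ∈ U' := by
      intro X hX Z hZ
      -- `X (1−E) Z u = [X, m] u + m X u`, `m = (1−E) Z E`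
      obtain ⟨-, hm, -⟩ := hcorner Z hZ
      have hmu : ((1 - E) * Z * E) u = (1 - E) (Z u) := by
        rw [Module.End.mul_apply, Module.End.mul_apply, hEu]
      have hXm : X * ((1 - E) * Z * E) - ((1 - E) * Z * E) * X ∈ 𝔏 := hbr X hX _ hm
      have e1 : (X * ((1 - E) * Z * E) - ((1 - E) * Z * E) * X) u = X (((1 - E) * Z * E) u) - ((1 - E) * Z * E) (X u) := by
        simp only [LinearMap.sub_apply, Module.End.mul_apply]
      have e2 : ((1 - E) * Z * E) (X u) = ε (X u) • (1 - E) (Z u) := by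
        rw [Module.End.mul_apply, Module.End.mul_apply, hEapply (X u), map_smul, map_smul]
      have heq : X ((1 - E) (Z u)) =
          (X * ((1 - E) * Z * E) - ((1 - E) * Z * E) * X) u + ε (X u) • (1 - E) (Z u) := by
        rw [e1, hmu, e2]; abel
      rw [heq]
      exact Submodule.add_mem _ (hYu _ hXm) (Submodule.smul_mem _ _ (hgenU' Z hZ))
    have hstab : ∀ X ∈ 𝔏, ∀ x ∈ U', X x ∈ U' := by
      intro X hX x hx
      obtain ⟨y, hy, z, hz, rfl⟩ := Submodule.mem_sup.1 hx
      obtain ⟨a, rfl⟩ := Submodule.mem_span_singleton.1 hy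
      obtain ⟨Z, hZ, rfl⟩ := hRmem z hz
      rw [map_add, map_smul]
      exact Submodule.add_mem _ (Submodule.smul_mem _ _ (hYu X hX)) (hXgen X hX Z hZ)
    have hU'top : U' = ⊤ := by
      rcases hirr U' hstab with h | h
      · exact absurd ((Submodule.mem_bot K).1 (h ▸ huU')) hu0
      · exact h
    intro w
    have hw : w ∈ U' := hU'top ▸ Submodule.mem_top
    obtain ⟨y, hy, z, hz, rfl⟩ := Submodule.mem_sup.1 hw
    obtain ⟨a, rfl⟩ := Submodule.mem_span_singleton.1 hy
    obtain ⟨Z, hZ, rfl⟩ := hRmem z hz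
    refine ⟨Z, hZ, ?_⟩
    rw [map_add, map_smul, h1Eu, smul_zero, zero_add, h1E1E]
  -- (B) a vector killed by `E` and by every `E Z`, `Z ∈ 𝔏`, is zero
  have hB : ∀ x : W, E x = 0 → (∀ Z ∈ 𝔏, E (Z x) = 0) → x = 0 := by
    set U'' : Submodule K W :=
      { carrier := {x | E x = 0 ∧ ∀ Z ∈ 𝔏, E (Z x) = 0}
        zero_mem' := ⟨map_zero E, fun Z _ => by rw [map_zero, map_zero]⟩
        add_mem' := fun {x y} hx hy => ⟨by rw [map_add, hx.1, hy.1, add_zero], fun Z hZ => by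
          rw [map_add, map_add, hx.2 Z hZ, hy.2 Z hZ, add_zero]⟩
        smul_mem' := fun a x hx => ⟨by rw [map_smul, hx.1, smul_zero], fun Z hZ => by
          rw [map_smul, map_smul, hx.2 Z hZ, smul_zero]⟩ } with hU''def
    have hstab : ∀ X ∈ 𝔏, ∀ x ∈ U'', X x ∈ U'' := by
      intro X hX x hx
      obtain ⟨hxE, hxZ⟩ := hx
      -- `X x = d_X x` with `d_X = EXE + (1−E)X(1−E) ∈ 𝔏`
      obtain ⟨-, -, hd⟩ := hcorner X hX
      have hx1E : (1 - E) x = x := by rw [h1E, hxE, sub_zero]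
      have hXx : X x = (E * X * E + (1 - E) * X * (1 - E)) x := by
        rw [LinearMap.add_apply, Module.End.mul_apply, Module.End.mul_apply, hxE, map_zero, map_zero, zero_add,
          Module.End.mul_apply, Module.End.mul_apply, hx1E, h1E, hxZ X hX, sub_zero]
      refine ⟨hxZ X hX, fun Z hZ => ?_⟩
      -- `E Z X x = E [Z, d_X] x + E d_X Z x = 0 + E X E Z x = 0`
      have hbrZ : Z * (E * X * E + (1 - E) * X * (1 - E)) - (E * X * E + (1 - E) * X * (1 - E)) * Z ∈ 𝔏 := hbr Z hZ _ hd
      have h0 := hxZ _ hbrZ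
      rw [LinearMap.sub_apply, Module.End.mul_apply, Module.End.mul_apply, map_sub, ← hXx] at h0
      have h2 : E ((E * X * E + (1 - E) * X * (1 - E)) (Z x)) = 0 := by
        rw [LinearMap.add_apply, map_add, Module.End.mul_apply, Module.End.mul_apply, hxZ Z hZ, map_zero, map_zero,
          map_zero, zero_add, Module.End.mul_apply, Module.End.mul_apply, hE1E]
      rw [h2, sub_zero] at h0
      exact h0
    have hU''bot : U'' = ⊥ := by
      rcases hirr U'' hstab with h | h
      · exact h
      · exfalso
        have hu : u ∈ U'' := h ▸ Submodule.mem_top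
        exact hu0 (by rw [← hEu]; exact hu.1)
    intro x hxE hxZ
    have hx : x ∈ U'' := ⟨hxE, hxZ⟩
    rw [hU''bot] at hx
    exact (Submodule.mem_bot K).1 hx
  -- (B') every functional `γ` with `γ u = 0` is `ε ∘ Z ∘ (1 − E)` for some `Z ∈ 𝔏`
  have hB' : ∀ γ : Module.Dual K W, γ u = 0 → ∃ Z ∈ 𝔏, γ = (ε ∘ₗ Z) ∘ₗ (1 - E) := by
    -- the space `S` of the functionals `ε ∘ Z ∘ (1−E)` inside `Ann = {γ : γ u = 0}`
    set σ : 𝔏 →ₗ[K] Module.Dual K W :=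
      { toFun := fun Z => (ε ∘ₗ (Z : Module.End K W)) ∘ₗ (1 - E)
        map_add' := fun Z Z' => by ext x; simp
        map_smul' := fun a Z => by ext x; simp } with hσ
    have hσapply : ∀ (Z : 𝔏) (x : W), σ Z x = ε ((Z : Module.End K W) ((1 - E) x)) := fun Z x => rfl
    set S : Submodule K (Module.Dual K W) := LinearMap.range σ with hSdef
    set Ann : Submodule K (Module.Dual K W) := LinearMap.ker (LinearMap.applyₗ (R := K) u) with hAnndef
    have hmemAnn : ∀ γ : Module.Dual K W, γ ∈ Ann ↔ γ u = 0 := fun γ => by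
      rw [hAnndef, LinearMap.mem_ker, LinearMap.applyₗ_apply_apply]
    have hSle : S ≤ Ann := by
      rintro _ ⟨Z, rfl⟩
      rw [hmemAnn, hσapply, h1Eu, map_zero, map_zero]
    -- `dim Ann = dim W − 1`
    have hn : Module.finrank K W = Module.finrank K (Module.Dual K W) := (Subspace.dual_finrank_eq).symm
    have hAnn : Module.finrank K Ann + 1 = Module.finrank K W := by
      have hsurj : LinearMap.range (LinearMap.applyₗ (R := K) (M₂ := K) u : Module.Dual K W →ₗ[K] K) = ⊤ := by
        rw [LinearMap.range_eq_top]
        intro c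
        refine ⟨c • ε, ?_⟩
        rw [LinearMap.applyₗ_apply_apply, LinearMap.smul_apply, hεu, smul_eq_mul, mul_one]
      have h := LinearMap.finrank_range_add_finrank_ker (LinearMap.applyₗ (R := K) (M₂ := K) u : Module.Dual K W →ₗ[K] K)
      rw [hsurj, finrank_top, Module.finrank_self] at h
      rw [hAnndef, hn, ← h, add_comm]
    -- `dim ker E + 1 = dim W`
    have hrange : LinearMap.range E = K ∙ u := by
      refine le_antisymm ?_ ?_
      · rintro _ ⟨x, rfl⟩
        rw [hEapply]; exact Submodule.smul_mem _ _ (Submodule.mem_span_singleton_self u)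
      · rw [Submodule.span_singleton_le_iff_mem]
        exact ⟨u, hEu⟩
    have hker : Module.finrank K (LinearMap.ker E) + 1 = Module.finrank K W := by
      have h := LinearMap.finrank_range_add_finrank_ker E
      rw [hrange, finrank_span_singleton hu0] at h
      omega
    -- the evaluation pairing `ker E → Dual S` is injective (B), so `dim ker E ≤ dim S`
    set ev : LinearMap.ker E →ₗ[K] Module.Dual K S :=
      { toFun := fun x =>
          { toFun := fun γ => (γ : Module.Dual K W) (x : W)
            map_add' := fun γ γ' => by simp
            map_smul' := fun a γ => by simp }
        map_add' := fun x y => by ext γ; simp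
        map_smul' := fun a x => by ext γ; simp } with hev
    have hevinj : Function.Injective ev := by
      rw [← LinearMap.ker_eq_bot, Submodule.eq_bot_iff]
      intro x hx
      rw [LinearMap.mem_ker] at hx
      have hxE : E (x : W) = 0 := LinearMap.mem_ker.1 x.2
      refine Subtype.ext (hB x hxE fun Z hZ => ?_)
      have h := LinearMap.congr_fun hx ⟨σ ⟨Z, hZ⟩, LinearMap.mem_range_self σ _⟩
      change σ ⟨Z, hZ⟩ (x : W) = 0 at h
      rw [hσapply, h1E, hxE, sub_zero] at h
      change ε (Z x) = 0 at h
      rw [hEapply, h, zero_smul]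
    haveI : FiniteDimensional K (Module.Dual K W) := inferInstance
    haveI : FiniteDimensional K S := FiniteDimensional.finiteDimensional_submodule S
    haveI : FiniteDimensional K (Module.Dual K S) := Subspace.instModuleDualFiniteDimensional (K := K) (V := ↥S)
    have hdimS : Module.finrank K (LinearMap.ker E) ≤ Module.finrank K S :=
      (LinearMap.finrank_le_finrank_of_injective hevinj).trans (Subspace.dual_finrank_eq (K := K) (V := S)).le
    have hSeq : S = Ann :=
      Submodule.eq_of_le_of_finrank_le hSle (by omega)
    intro γ hγ
    have hγS : γ ∈ S := by rw [hSeq, hmemAnn]; exact hγ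
    obtain ⟨Z, hZ⟩ := hγS
    exact ⟨Z, Z.2, hZ.symm⟩
  -- (C) assembly: every `F` lies in `𝔏`
  rw [eq_top_iff]
  rintro F -
  -- the four blocks of `F`
  have hsplit : F = E * F * E + E * F * (1 - E) + (1 - E) * F * E + (1 - E) * F * (1 - E) := by
    simp only [mul_sub, sub_mul, mul_one, one_mul]; abel
  -- (iv) `EFE = ε(Fu) E`
  have h4 : E * F * E ∈ 𝔏 := by
    have h : E * F * E = ε (F u) • E := LinearMap.ext fun x => by
      rw [Module.End.mul_apply, Module.End.mul_apply, hEapply x, map_smul, map_smul, hEapply (F u), LinearMap.smul_apply,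
        hEapply x, smul_smul, smul_smul, mul_comm]
    rw [h]; exact 𝔏.smul_mem _ hE
  -- (iii) `(1−E)FE = (1−E)ZE`
  have h3 : (1 - E) * F * E ∈ 𝔏 := by
    obtain ⟨Z, hZ, hZu⟩ := hA (F u)
    obtain ⟨-, hm, -⟩ := hcorner Z hZ
    have h : (1 - E) * F * E = (1 - E) * Z * E := LinearMap.ext fun x => by
      rw [Module.End.mul_apply, Module.End.mul_apply, hEapply x, map_smul, map_smul, hZu, Module.End.mul_apply,
        Module.End.mul_apply, hEapply x, map_smul, map_smul]
    rw [h]; exact hm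
  -- (ii) `EF(1−E) = EZ(1−E)`
  have h2 : E * F * (1 - E) ∈ 𝔏 := by
    obtain ⟨Z, hZ, hγ⟩ := hB' ((ε ∘ₗ F) ∘ₗ (1 - E)) (by
      rw [LinearMap.comp_apply, LinearMap.comp_apply, h1Eu, map_zero, map_zero])
    obtain ⟨hn, -, -⟩ := hcorner Z hZ
    have h : E * F * (1 - E) = E * Z * (1 - E) := LinearMap.ext fun x => by
      have hx := LinearMap.congr_fun hγ x
      simp only [LinearMap.comp_apply] at hx
      rw [Module.End.mul_apply, Module.End.mul_apply, hEapply, hx, Module.End.mul_apply, Module.End.mul_apply, ← hEapply]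
    rw [h]; exact hn
  -- (i) `(1−E)F(1−E)` is a sum of `k ⊗ γ = γ(k)E − [u ⊗ γ, k ⊗ ε]`
  have hkγ : ∀ (k : W) (γ : Module.Dual K W), E k = 0 → γ u = 0 → γ.smulRight k ∈ 𝔏 := by
    intro k γ hk hγ
    -- `u ⊗ γ ∈ 𝔏` and `k ⊗ ε ∈ 𝔏`
    obtain ⟨Z, hZ, hγZ⟩ := hB' γ hγ
    obtain ⟨hn, -, -⟩ := hcorner Z hZ
    have hnγ : E * Z * (1 - E) = γ.smulRight u := LinearMap.ext fun x => by
      rw [Module.End.mul_apply, Module.End.mul_apply, hEapply, LinearMap.smulRight_apply, hγZ]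
      rfl
    obtain ⟨Z', hZ', hZ'u⟩ := hA k
    obtain ⟨-, hm, -⟩ := hcorner Z' hZ'
    have hk1 : (1 - E) k = k := by rw [h1E, hk, sub_zero]
    have hmε : (1 - E) * Z' * E = ε.smulRight k := LinearMap.ext fun x => by
      rw [Module.End.mul_apply, Module.End.mul_apply, hEapply x, map_smul, map_smul, ← hZ'u, hk1, LinearMap.smulRight_apply]
    have hbr' := hbr _ (hnγ ▸ hn) _ (hmε ▸ hm)
    -- `[u ⊗ γ, k ⊗ ε] = γ(k) E − k ⊗ γ`
    have hcomm : γ.smulRight u * ε.smulRight k - ε.smulRight k * γ.smulRight u = γ k • E - γ.smulRight k :=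
      LinearMap.ext fun x => by
        simp only [LinearMap.sub_apply, Module.End.mul_apply, LinearMap.smulRight_apply, map_smul, hεu,
          LinearMap.smul_apply, hEapply, mul_one, smul_smul]
        rw [mul_comm (ε x) (γ k)]
    rw [hcomm] at hbr'
    have h := 𝔏.sub_mem (𝔏.smul_mem (γ k) hE) hbr'
    rwa [sub_sub_cancel] at h
  have h1 : (1 - E) * F * (1 - E) ∈ 𝔏 := by
    -- expand in a basis: `(1−E)F(1−E) = Σ_i ((1−E) F bᵢ) ⊗ (coordᵢ ∘ (1−E))`
    set b := Module.finBasis K W with hb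
    have hexp : (1 - E) * F * (1 - E) =
        ∑ i, ((b.coord i) ∘ₗ (1 - E)).smulRight ((1 - E) (F (b i))) := by
      refine LinearMap.ext fun x => ?_
      rw [Module.End.mul_apply, Module.End.mul_apply, LinearMap.sum_apply]
      simp only [LinearMap.smulRight_apply, LinearMap.comp_apply]
      conv_lhs => rw [← b.sum_repr ((1 - E) x)]
      rw [map_sum, map_sum]
      refine Finset.sum_congr rfl fun i _ => ?_
      rw [map_smul, map_smul, Module.Basis.coord_apply]
    rw [hexp]
    refine Submodule.sum_mem _ fun i _ => hkγ _ _ (hE1E _) ?_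
    rw [LinearMap.comp_apply, h1Eu, map_zero]
  rw [hsplit]
  exact 𝔏.add_mem (𝔏.add_mem (𝔏.add_mem h4 h2) h3) h1

/-- **Corollary (the form used on the Hodge side).** If `𝔏` is irreducible, commutator-closed and contains an operator `P` of rank one
with `tr P ≠ 0` — equivalently `P = u ⊗ α` with `α(u) ≠ 0`, e.g. `P = N N†` for a rank-one raising element `N` of a unitary Hodge Lie
algebra — then `𝔏 = End_K(W)` (`E = α(u)⁻¹ P` is a rank-one idempotent in `𝔏`). [cite: Humphreys1972, §19.1 Proposition and §19.2] -/
theorem eq_top_of_irreducible_of_smulRight_mem {𝔏 : Submodule K (Module.End K W)}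
    (hbr : ∀ A ∈ 𝔏, ∀ B ∈ 𝔏, A * B - B * A ∈ 𝔏)
    (hirr : ∀ U : Submodule K W, (∀ A ∈ 𝔏, ∀ x ∈ U, A x ∈ U) → U = ⊥ ∨ U = ⊤)
    {α : Module.Dual K W} {u : W} (hP : α.smulRight u ∈ 𝔏) (hαu : α u ≠ 0) : 𝔏 = ⊤ := by
  refine eq_top_of_irreducible_of_idempotent_rankOne hbr hirr (E := (α u)⁻¹ • α.smulRight u) (ε := (α u)⁻¹ • α) (u := u)
    (𝔏.smul_mem _ hP) (fun x => ?_) ?_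
  · rw [LinearMap.smul_apply, LinearMap.smulRight_apply, LinearMap.smul_apply, smul_smul, smul_eq_mul]
  · rw [LinearMap.smul_apply, smul_eq_mul, inv_mul_cancel₀ hαu]

end Literature.Algebra.Lie
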